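import Mathlib
import Summits.NavierStokesRegularity.FluidComputer.TransportGalerkinBox
import HarnessLib

/-!
# Certificate weights on the phase space `E`: diagonal multipliers, the tail inequality from a symbol inequality, head∣tail pairings as finite sums (instab g18, cell `ns-blowup`, 2026-08-27)

HONEST FRAMING (human ruling D-0035): nothing here is a claim about Navier–Stokes blow-up.
WHAT THIS IS NOT: not NS evidence — plumbing for the users of the (β2) KEEP/KILL schema
(`TransportGalerkinShift.half_prediction_nsField_shift`, `TransportGalerkinAbcShift.half_prediction_abc_shift`,
`HOME/instab/BETA2-SPEC.md` §10–§11): the certificate OBJECTS `G₁, G₂, G : E →L[ℝ] E` are «dense head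
block on the cube `|k|_∞ ≤ K` ⊕ DIAGONAL tail». This file supplies, for general finite `d` and Hilbert `V`:

* §1 `exists_diagCLM` — a bounded real symbol `g : ℤ^d → ℝ` acts on `E = ℓ²(ℤ^d; V)` as a bounded
  real-linear map `D` with `⇑(D z) = (g k • z k)_k`; for ANY map with this action: `inner_diag_eq_tsum`
  (`⟪D x, y⟫ = ∑_k g(k) ⟪x k, y k⟫`), `diag_symm` (symmetric), `diag_cubeProj_comm` (`P_n`-compatible for
  EVERY cube truncation), `re_inner_diag_self_eq_tsum` (`Re⟪D x, x⟫ = ∑_k g(k) ‖x k‖²`), and the two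
  comparison constants `diag_lower` / `diag_upper` (`m ≤ g ≤ M ⇒ m‖x‖² ≤ Re⟪D x, x⟫ ≤ M‖x‖²`).
* §2 **`tail_ineq_of_symbol_ineq`** — THE TAIL INEQUALITY `htail` of the schema from a POINTWISE symbol
  inequality: if `G₁, G₂` act diagonally with symbols `g₁, g₂` on the vectors vanishing on the cube `K`,
  and `2μ g₁(k) + c g₂(k) ≤ 2ω g₁(k)` off that cube, then for every level `n` and every `q` with
  `cubeProj (n + K) q = 0`: `2μ Re⟪G₁q, q⟫ + c Re⟪G₂q, q⟫ ≤ 2ω Re⟪G₁q, q⟫` (BETA2-SPEC §7 «htail: G₂ ≤ κ₀⁻² G₁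
  on the tail ⇒ take μ ≤ min(ω₁, ω) − c/(2κ₀²)» made kernel).
* §3 `inner_eq_sum_of_cubeProj_eq` — a pairing against a vector in the range of `P_n` is a FINITE sum
  over the cube; `inner_apply_eq_inner_cubeProj_apply` — for a `P_n`-compatible weight `G` and
  `p = P_n w`, `⟪G p, A p⟫ = ⟪G p, P_n (A p)⟫`: the certificate inequalities h₁/h₂/hL at level `n` are
  inequalities between finite quadratic forms on the cube (the Galerkin compression of `A = linOp`, whose
  entries are `TransportGalerkinEigenFourier.coe_linOp_abc_apply` for the ABC host).

Mathlib + the tree files cited; no new definitions.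
-/

noncomputable section

namespace Summit.NavierStokesRegularity.FluidComputer.TransportGalerkinWeights

open Set Filter Topology Finset RCLike
open Literature.Analysis.FunctionSpaces Literature.Analysis.FunctionSpaces.Lattice
open Literature.Analysis.FunctionSpaces.Torus Literature.Analysis.ODE
open Summit.NavierStokesRegularity.FluidComputer.GalerkinLatticePhaseSpace
open Summit.NavierStokesRegularity.FluidComputer.TransportGalerkin
open Summit.NavierStokesRegularity.FluidComputer.TransportGalerkinBox
open scoped ENNReal NNReal ComplexConjugate InnerProductSpace

variable {d : Type*} [Fintype d] [DecidableEq d]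
variable {V : Type*} [NormedAddCommGroup V] [InnerProductSpace ℂ V] [CompleteSpace V]

/-! ## §1 Diagonal multipliers -/

section Diag

variable {g : (d → ℤ) → ℝ}

omit [DecidableEq d] [InnerProductSpace ℂ V] [CompleteSpace V] in
/-- A bounded real symbol times an `ℓ²` family is an `ℓ²` family; its `ofCoeff` has these coefficients. -/
theorem coe_ofCoeff_diag [NormedSpace ℂ V] {M : ℝ} (hg : ∀ k, |g k| ≤ M) (z : lp (fun _ : (d → ℤ) => V) 2) :
    ⇑(ofCoeff (fun k => (g k : ℂ) • z k)) = fun k => (g k : ℂ) • z k := by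
  refine coe_ofCoeff_of_eNormSq_lt_top ?_
  have hM : 0 ≤ M := (abs_nonneg _).trans (hg 0)
  have h : eNormSq 0 (fun k => (g k : ℂ) • z k) ≤ ENNReal.ofReal (M ^ 2) * eNormSq (0 + 0) (⇑z) :=
    eNormSq_le_of_norm_le hM fun k => by
      rw [norm_smul, Complex.norm_real, Real.norm_eq_abs, sobolevWeight_zero, mul_one]
      exact mul_le_mul_of_nonneg_right (hg k) (norm_nonneg _)
  rw [add_zero] at h
  exact h.trans_lt (ENNReal.mul_lt_top ENNReal.ofReal_lt_top (eNormSq_zero_coe_lt_top z))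

omit [DecidableEq d] [InnerProductSpace ℂ V] [CompleteSpace V] in
/-- **A bounded real symbol acts on `E` as a bounded real-linear map**: `⇑(D z) = (g k • z k)_k`. -/
theorem exists_diagCLM [NormedSpace ℂ V] {M : ℝ} (hg : ∀ k, |g k| ≤ M) :
    ∃ D : lp (fun _ : (d → ℤ) => V) 2 →L[ℝ] lp (fun _ : (d → ℤ) => V) 2,
      ∀ z, ⇑(D z) = fun k => (g k : ℂ) • z k := by
  have hM : 0 ≤ M := (abs_nonneg _).trans (hg 0)
  refine ⟨LinearMap.mkContinuous
    { toFun := fun z => ofCoeff (fun k => (g k : ℂ) • z k)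
      map_add' := fun x y => by
        refine lp.ext ?_
        rw [coe_ofCoeff_diag hg (x + y), lp.coeFn_add, lp.coeFn_add, coe_ofCoeff_diag hg x, coe_ofCoeff_diag hg y]
        funext k; simp only [Pi.add_apply, smul_add]
      map_smul' := fun r x => by
        refine lp.ext ?_
        rw [coe_ofCoeff_diag hg (r • x), lp.coeFn_smul, RingHom.id_apply, lp.coeFn_smul, coe_ofCoeff_diag hg x]
        funext k
        simp only [Pi.smul_apply, ← Complex.coe_smul, smul_smul, mul_comm] } M fun z => ?_,
    fun z => coe_ofCoeff_diag hg z⟩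
  -- `‖D z‖ ≤ M ‖z‖`
  have h : eNormSq 0 (⇑(ofCoeff (fun k => (g k : ℂ) • z k))) ≤ ENNReal.ofReal (M ^ 2) * eNormSq (0 + 0) (⇑z) := by
    rw [coe_ofCoeff_diag hg z]
    exact eNormSq_le_of_norm_le hM fun k => by
      rw [norm_smul, Complex.norm_real, Real.norm_eq_abs, sobolevWeight_zero, mul_one]
      exact mul_le_mul_of_nonneg_right (hg k) (norm_nonneg _)
  rw [add_zero] at h
  have h2 := ENNReal.toReal_mono (ENNReal.mul_ne_top ENNReal.ofReal_ne_top (eNormSq_zero_coe_lt_top z).ne) h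
  rw [ENNReal.toReal_mul, ENNReal.toReal_ofReal (sq_nonneg M), ← norm_sq_eq_toReal_eNormSq_zero,
    ← norm_sq_eq_toReal_eNormSq_zero, ← mul_pow] at h2
  exact (pow_le_pow_iff_left₀ (norm_nonneg _) (mul_nonneg hM (norm_nonneg _)) two_ne_zero).1 h2

variable {D : lp (fun _ : (d → ℤ) => V) 2 →L[ℝ] lp (fun _ : (d → ℤ) => V) 2}

omit [Fintype d] [DecidableEq d] [CompleteSpace V] in
/-- **Pairings against a diagonal weight**: `⟪D x, y⟫ = ∑_k g(k)·⟪x k, y k⟫`. -/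
theorem inner_diag_eq_tsum (hD : ∀ z, ⇑(D z) = fun k => (g k : ℂ) • z k)
    (x y : lp (fun _ : (d → ℤ) => V) 2) :
    ⟪D x, y⟫_ℂ = ∑' k, (g k : ℂ) * ⟪x k, y k⟫_ℂ := by
  rw [lp.inner_eq_tsum]
  refine tsum_congr fun k => ?_
  rw [show (D x : (d → ℤ) → V) k = (g k : ℂ) • x k from congrFun (hD x) k, inner_smul_left, Complex.conj_ofReal]

omit [Fintype d] [DecidableEq d] [CompleteSpace V] in
/-- **A diagonal weight is symmetric.** -/
theorem diag_symm (hD : ∀ z, ⇑(D z) = fun k => (g k : ℂ) • z k) (x y : lp (fun _ : (d → ℤ) => V) 2) :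
    ⟪D x, y⟫_ℂ = ⟪x, D y⟫_ℂ := by
  rw [inner_diag_eq_tsum hD, lp.inner_eq_tsum]
  refine tsum_congr fun k => ?_
  rw [show (D y : (d → ℤ) → V) k = (g k : ℂ) • y k from congrFun (hD y) k, inner_smul_right]

omit [CompleteSpace V] in
/-- **A diagonal weight is `P_n`-compatible for every cube truncation**: `⟪D w, P_n z⟫ = ⟪D (P_n w), z⟫`. -/
theorem diag_cubeProj_comm (hD : ∀ z, ⇑(D z) = fun k => (g k : ℂ) • z k) (n : ℕ)
    (w z : lp (fun _ : (d → ℤ) => V) 2) :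
    ⟪D w, cubeProj n z⟫_ℂ = ⟪D (cubeProj n w), z⟫_ℂ := by
  rw [inner_diag_eq_tsum hD, inner_diag_eq_tsum hD]
  refine tsum_congr fun k => ?_
  rw [cubeProj_apply, cubeProj_apply]
  split_ifs
  · rfl
  · rw [inner_zero_right, inner_zero_left]

omit [Fintype d] [DecidableEq d] [CompleteSpace V] in
/-- **A diagonal quadratic form, pointwise version**: if `⇑y = (g k • x k)_k` for a bounded real symbol
`g`, then `Re⟪y, x⟫ = ∑_k g(k)·‖x k‖²` (a convergent real series). -/
theorem re_inner_eq_tsum_of_coe {x y : lp (fun _ : (d → ℤ) => V) 2} (hy : ⇑y = fun k => (g k : ℂ) • x k)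
    {M : ℝ} (hg : ∀ k, |g k| ≤ M) :
    re ⟪y, x⟫_ℂ = ∑' k, g k * ‖x k‖ ^ 2 := by
  have h2 : HasSum (fun k => ‖x k‖ ^ 2) (‖x‖ ^ 2) := by
    have := lp.hasSum_norm (by norm_num : 0 < (2 : ℝ≥0∞).toReal) x
    simpa using this
  have hs : Summable fun k => g k * ‖x k‖ ^ 2 := by
    refine Summable.of_norm_bounded (h2.summable.mul_left M) fun k => ?_
    rw [norm_mul, Real.norm_eq_abs, Real.norm_of_nonneg (sq_nonneg _)]
    exact mul_le_mul_of_nonneg_right (hg k) (sq_nonneg _)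
  have hterm : ∀ k, (g k : ℂ) * ⟪x k, x k⟫_ℂ = ((g k * ‖x k‖ ^ 2 : ℝ) : ℂ) := fun k => by
    rw [inner_self_eq_norm_sq_to_K (𝕜 := ℂ) (x k)]
    push_cast
    rfl
  have hsC : Summable fun k => (g k : ℂ) * ⟪x k, x k⟫_ℂ := by
    simp_rw [hterm]; exact Complex.summable_ofReal.2 hs
  have hin : ⟪y, x⟫_ℂ = ∑' k, (g k : ℂ) * ⟪x k, x k⟫_ℂ := by
    rw [lp.inner_eq_tsum]
    refine tsum_congr fun k => ?_
    rw [show (y : (d → ℤ) → V) k = (g k : ℂ) • x k from congrFun hy k, inner_smul_left, Complex.conj_ofReal]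
  rw [show re ⟪y, x⟫_ℂ = (⟪y, x⟫_ℂ).re from rfl, hin, Complex.re_tsum hsC]
  simp_rw [hterm, Complex.ofReal_re]

omit [Fintype d] [DecidableEq d] [InnerProductSpace ℂ V] [CompleteSpace V] in
/-- Summability of the diagonal quadratic form's terms. -/
theorem summable_symbol_mul_norm_sq {M : ℝ} (hg : ∀ k, |g k| ≤ M) (x : lp (fun _ : (d → ℤ) => V) 2) :
    Summable fun k => g k * ‖x k‖ ^ 2 := by
  have h2 : HasSum (fun k => ‖x k‖ ^ 2) (‖x‖ ^ 2) := by
    have := lp.hasSum_norm (by norm_num : 0 < (2 : ℝ≥0∞).toReal) x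
    simpa using this
  refine Summable.of_norm_bounded (h2.summable.mul_left M) fun k => ?_
  rw [norm_mul, Real.norm_eq_abs, Real.norm_of_nonneg (sq_nonneg _)]
  exact mul_le_mul_of_nonneg_right (hg k) (sq_nonneg _)

omit [Fintype d] [DecidableEq d] [CompleteSpace V] in
/-- **The diagonal quadratic form**: `Re⟪D x, x⟫ = ∑_k g(k)·‖x k‖²`. -/
theorem re_inner_diag_self_eq_tsum (hD : ∀ z, ⇑(D z) = fun k => (g k : ℂ) • z k) {M : ℝ} (hg : ∀ k, |g k| ≤ M)
    (x : lp (fun _ : (d → ℤ) => V) 2) :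
    re ⟪D x, x⟫_ℂ = ∑' k, g k * ‖x k‖ ^ 2 :=
  re_inner_eq_tsum_of_coe (hD x) hg

omit [Fintype d] [DecidableEq d] [CompleteSpace V] in
/-- Lower comparison constant: `m ≤ g ⇒ m‖x‖² ≤ Re⟪D x, x⟫`. -/
theorem diag_lower (hD : ∀ z, ⇑(D z) = fun k => (g k : ℂ) • z k) {M m : ℝ} (hg : ∀ k, |g k| ≤ M)
    (hm : ∀ k, m ≤ g k) (x : lp (fun _ : (d → ℤ) => V) 2) :
    m * ‖x‖ ^ 2 ≤ re ⟪D x, x⟫_ℂ := by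
  have h2 : HasSum (fun k => ‖x k‖ ^ 2) (‖x‖ ^ 2) := by
    have := lp.hasSum_norm (by norm_num : 0 < (2 : ℝ≥0∞).toReal) x
    simpa using this
  have hs : Summable fun k => g k * ‖x k‖ ^ 2 := by
    refine Summable.of_norm_bounded (h2.summable.mul_left M) fun k => ?_
    rw [norm_mul, Real.norm_eq_abs, Real.norm_of_nonneg (sq_nonneg _)]
    exact mul_le_mul_of_nonneg_right (hg k) (sq_nonneg _)
  rw [re_inner_diag_self_eq_tsum hD hg, ← h2.tsum_eq, ← tsum_mul_left]
  exact Summable.tsum_le_tsum (fun k => mul_le_mul_of_nonneg_right (hm k) (sq_nonneg _)) (h2.summable.mul_left m) hs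

omit [Fintype d] [DecidableEq d] [CompleteSpace V] in
/-- Upper comparison constant: `g ≤ M' ⇒ Re⟪D x, x⟫ ≤ M'‖x‖²`. -/
theorem diag_upper (hD : ∀ z, ⇑(D z) = fun k => (g k : ℂ) • z k) {M M' : ℝ} (hg : ∀ k, |g k| ≤ M)
    (hM : ∀ k, g k ≤ M') (x : lp (fun _ : (d → ℤ) => V) 2) :
    re ⟪D x, x⟫_ℂ ≤ M' * ‖x‖ ^ 2 := by
  have h2 : HasSum (fun k => ‖x k‖ ^ 2) (‖x‖ ^ 2) := by
    have := lp.hasSum_norm (by norm_num : 0 < (2 : ℝ≥0∞).toReal) x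
    simpa using this
  have hs : Summable fun k => g k * ‖x k‖ ^ 2 := by
    refine Summable.of_norm_bounded (h2.summable.mul_left M) fun k => ?_
    rw [norm_mul, Real.norm_eq_abs, Real.norm_of_nonneg (sq_nonneg _)]
    exact mul_le_mul_of_nonneg_right (hg k) (sq_nonneg _)
  rw [re_inner_diag_self_eq_tsum hD hg, ← h2.tsum_eq, ← tsum_mul_left]
  exact Summable.tsum_le_tsum (fun k => mul_le_mul_of_nonneg_right (hM k) (sq_nonneg _)) hs (h2.summable.mul_left M')

end Diag

/-! ## §2 The tail inequality from a pointwise symbol inequality -/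

section Tail

omit [CompleteSpace V] in
/-- A vector killed by `cubeProj (n + K)` is killed by `cubeProj K` and vanishes on the cube `n + K`. -/
theorem cubeProj_eq_zero_of_le {K m : ℕ} (hKm : K ≤ m) {q : lp (fun _ : (d → ℤ) => V) 2} (hq : cubeProj m q = 0) :
    cubeProj K q = 0 := by
  rw [← lpProj_cube_nested_le hKm q, ← cubeProj_eq, ← cubeProj_eq, hq, map_zero]

omit [CompleteSpace V] in
/-- Coefficients on the cube of a vector killed by the cube truncation vanish. -/
theorem apply_eq_zero_of_cubeProj_eq_zero {m : ℕ} {q : lp (fun _ : (d → ℤ) => V) 2} (hq : cubeProj m q = 0)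
    {k : d → ℤ} (hk : k ∈ Fintype.piFinset fun _ : d => Finset.Icc (-(m : ℤ)) m) : (q : (d → ℤ) → V) k = 0 := by
  have h := congrArg (fun z : lp (fun _ : (d → ℤ) => V) 2 => (z : (d → ℤ) → V) k) hq
  simp only [cubeProj_apply, if_pos hk, lp.coeFn_zero, Pi.zero_apply] at h
  exact h

omit [CompleteSpace V] in
/-- **The tail inequality `htail` of the schema from a POINTWISE symbol inequality.** If `G₁, G₂` act
diagonally, with bounded real symbols `g₁, g₂`, on every vector killed by `cubeProj K`, and
`2μ·g₁(k) + c·g₂(k) ≤ 2ω·g₁(k)` at every mode off the cube `K`, then for every level `n` and every `q`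
with `cubeProj (n + K) q = 0`: `2μ Re⟪G₁q, q⟫ + c Re⟪G₂q, q⟫ ≤ 2ω Re⟪G₁q, q⟫`. -/
theorem tail_ineq_of_symbol_ineq (K : ℕ)
    {G₁ G₂ : lp (fun _ : (d → ℤ) => V) 2 →L[ℝ] lp (fun _ : (d → ℤ) => V) 2} {g₁ g₂ : (d → ℤ) → ℝ} {M : ℝ}
    (hg₁ : ∀ k, |g₁ k| ≤ M) (hg₂ : ∀ k, |g₂ k| ≤ M)
    (hG₁ : ∀ q : lp (fun _ : (d → ℤ) => V) 2, cubeProj K q = 0 → ⇑(G₁ q) = fun k => (g₁ k : ℂ) • q k)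
    (hG₂ : ∀ q : lp (fun _ : (d → ℤ) => V) 2, cubeProj K q = 0 → ⇑(G₂ q) = fun k => (g₂ k : ℂ) • q k)
    {μ c ω : ℝ}
    (hsym : ∀ k, k ∉ (Fintype.piFinset fun _ : d => Finset.Icc (-(K : ℤ)) K) → 2 * μ * g₁ k + c * g₂ k ≤ 2 * ω * g₁ k) :
    ∀ n, ∀ q : lp (fun _ : (d → ℤ) => V) 2, cubeProj (n + K) q = 0 →
      2 * μ * re ⟪G₁ q, q⟫_ℂ + c * re ⟪G₂ q, q⟫_ℂ ≤ 2 * ω * re ⟪G₁ q, q⟫_ℂ := by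
  intro n q hq
  have hqK : cubeProj K q = 0 := cubeProj_eq_zero_of_le (by omega) hq
  rw [re_inner_eq_tsum_of_coe (hG₁ q hqK) hg₁, re_inner_eq_tsum_of_coe (hG₂ q hqK) hg₂]
  have hs₁ := summable_symbol_mul_norm_sq hg₁ q
  have hs₂ := summable_symbol_mul_norm_sq hg₂ q
  rw [← tsum_mul_left, ← tsum_mul_left, ← tsum_mul_left, ← (hs₁.mul_left (2 * μ)).tsum_add (hs₂.mul_left c)]
  refine Summable.tsum_le_tsum (fun k => ?_) ((hs₁.mul_left (2 * μ)).add (hs₂.mul_left c)) (hs₁.mul_left (2 * ω))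
  by_cases hk : k ∈ Fintype.piFinset fun _ : d => Finset.Icc (-((n + K : ℕ) : ℤ)) (n + K : ℕ)
  · rw [apply_eq_zero_of_cubeProj_eq_zero hq hk, norm_zero]; simp
  · have hkK : k ∉ (Fintype.piFinset fun _ : d => Finset.Icc (-(K : ℤ)) K) := fun h => hk (cube_mono (by omega) h)
    have h := mul_le_mul_of_nonneg_right (hsym k hkK) (sq_nonneg ‖q k‖)
    calc 2 * μ * (g₁ k * ‖q k‖ ^ 2) + c * (g₂ k * ‖q k‖ ^ 2) = (2 * μ * g₁ k + c * g₂ k) * ‖q k‖ ^ 2 := by ring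
      _ ≤ 2 * ω * g₁ k * ‖q k‖ ^ 2 := h
      _ = 2 * ω * (g₁ k * ‖q k‖ ^ 2) := by ring

end Tail

/-! ## §3 Head∣tail pairings are finite sums -/

section Finite

omit [CompleteSpace V] in
/-- **A pairing against a vector in the range of `P_n` is a finite sum over the cube.** -/
theorem inner_eq_sum_of_cubeProj_eq {n : ℕ} {y : lp (fun _ : (d → ℤ) => V) 2} (hy : cubeProj n y = y)
    (z : lp (fun _ : (d → ℤ) => V) 2) :
    ⟪y, z⟫_ℂ = ∑ k ∈ Fintype.piFinset (fun _ : d => Finset.Icc (-(n : ℤ)) n), ⟪y k, z k⟫_ℂ := by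
  rw [lp.inner_eq_tsum]
  refine tsum_eq_sum fun k hk => ?_
  have h : (y : (d → ℤ) → V) k = 0 := by
    rw [← hy, cubeProj_apply, if_neg hk]
  rw [h, inner_zero_left]

omit [CompleteSpace V] in
/-- **For a `P_n`-compatible weight, the certificate pairing sees only the Galerkin compression**:
`⟪G (P_n w), A (P_n w)⟫ = ⟪G (P_n w), P_n (A (P_n w))⟫` (so h₁/h₂/hL at level `n` are inequalities
between finite quadratic forms on the cube). -/
theorem inner_apply_eq_inner_cubeProj_apply {n : ℕ}
    {G : lp (fun _ : (d → ℤ) => V) 2 →L[ℝ] lp (fun _ : (d → ℤ) => V) 2}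
    (hGP : ∀ w z : lp (fun _ : (d → ℤ) => V) 2, ⟪G w, cubeProj n z⟫_ℂ = ⟪G (cubeProj n w), z⟫_ℂ)
    (A : lp (fun _ : (d → ℤ) => V) 2 → lp (fun _ : (d → ℤ) => V) 2) (w : lp (fun _ : (d → ℤ) => V) 2) :
    ⟪G (cubeProj n w), A (cubeProj n w)⟫_ℂ = ⟪G (cubeProj n w), cubeProj n (A (cubeProj n w))⟫_ℂ := by
  rw [hGP (cubeProj n w), cubeProj_eq, lpProj_idem]

end Finite

end Summit.NavierStokesRegularity.FluidComputer.TransportGalerkinWeights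

end
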